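import Summits.ValiantsHypothesis.ValiantsHypothesis.Theorems.KPlusLogSqLawOctaveDepthAtoms

/-!
# Route «KPlusLogSqLaw», octave line — file 6/7: Leibniz bookkeeping, the depth confinement `rootNearBreakpoint_proof` and the unit-cell count `cellCount_proof`

HONEST FRAMING.  Octave line of ideator seat val-idea-6 (crux-idea `octave-lifting` on stmt-ValiantsHypothesis-19561, critic-1 PASS 2026-08-27), published as `Cruxes/WeakLifting/Lines/octave.lean`; landed in Theorems shape by prover seat val-width-19561-oc1 (`--supports stmt-ValiantsHypothesis-19561`).  Conjecture B (`KPlusLogSqLaw`), `TropicalB` (stmt-19771), `WeakLifting` (stmt-19561), `MatrixDescartes` (stmt-18050) and the octave statements `OctaveWeakLifting` / `OctaveKLaw` / `OctaveMatrixDescartes` are OPEN and DEFINED, never asserted; nothing in this file proves any of them, and VP ≠ VNP is not moved.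

This file: `pencilDet_eq_sum` (det = Σ_τ rawCoef·X^rawSlope), `eval_pencilDet_eq_sum`, `coeff_pencilDet_eq_sum`, `abs_rawCoef`, `card_rawTerm_le`, `sign_div_abs`, `rootNearBreakpoint_proof : RootNearBreakpoint`, `octave_eq_floor`, `cellCount_proof : CellCount`.
-/

set_option linter.dupNamespace false
set_option autoImplicit false

namespace Summit.ValiantsHypothesis.ValiantsHypothesis.Theorems.KPlusLogSqLaw.Octave

open Polynomial Finset
open scoped BigOperators
open Summit.ValiantsHypothesis.ValiantsHypothesis.Theorems.LacunarySymmetroidMatrixDescartes (RealRootLawAt KPlusLogSqLaw)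
open Summit.ValiantsHypothesis.ValiantsHypothesis.Theses.LacunarySymmetroid (MatrixDescartes PencilTransfer ThetaWitness)
open Summit.ValiantsHypothesis.ValiantsHypothesis.Theses.KPlusLogSqLaw (TropicalB WeakLifting)

section Depth

open Finset

variable {m K : ℕ}

/-- Leibniz bookkeeping: the pencil determinant is the sum of its raw terms. -/
theorem pencilDet_eq_sum (d : Fin K → ℕ) (S : Fin K → Matrix (Fin m) (Fin m) ℝ) :
    pencilDet d S = ∑ τ : RawTerm m K, Polynomial.C (rawCoef S τ) * Polynomial.X ^ (rawSlope d τ) := by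
  classical
  unfold pencilDet
  rw [Matrix.det_apply', Fintype.sum_prod_type]
  refine Finset.sum_congr rfl fun σ _ => ?_
  have hentry : ∀ i, (∑ l, ((Polynomial.X : Polynomial ℝ) ^ d l) • (S l).map Polynomial.C) (σ i) i
      = ∑ l, Polynomial.X ^ d l * Polynomial.C (S l (σ i) i) := by
    intro i
    simp [Matrix.sum_apply, Matrix.smul_apply, Matrix.map_apply, smul_eq_mul]
  rw [Finset.prod_congr rfl fun i _ => hentry i, Finset.prod_univ_sum, Finset.mul_sum]
  simp only [Fintype.piFinset_univ]
  refine Finset.sum_congr rfl fun lam _ => ?_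
  rw [Finset.prod_mul_distrib, Finset.prod_pow_eq_pow_sum, rawCoef, rawSlope, map_mul, map_intCast, map_prod]
  ring

/-- Evaluation of the pencil determinant as the sum of its raw Leibniz terms. [folklore] -/
theorem eval_pencilDet_eq_sum (d : Fin K → ℕ) (S : Fin K → Matrix (Fin m) (Fin m) ℝ) (x : ℝ) :
    (pencilDet d S).eval x = ∑ τ : RawTerm m K, rawCoef S τ * x ^ (rawSlope d τ) := by
  rw [pencilDet_eq_sum, Polynomial.eval_finsetSum]
  simp [Polynomial.eval_mul, Polynomial.eval_pow, Polynomial.eval_C, Polynomial.eval_X]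

/-- A coefficient of the pencil determinant is the signed sum of the raw terms of its slope class. [folklore] -/
theorem coeff_pencilDet_eq_sum (d : Fin K → ℕ) (S : Fin K → Matrix (Fin m) (Fin m) ℝ) (e : ℕ) :
    (pencilDet d S).coeff e = ∑ τ ∈ univ.filter (fun τ : RawTerm m K => rawSlope d τ = e), rawCoef S τ := by
  classical
  rw [pencilDet_eq_sum, Polynomial.finsetSum_coeff, Finset.sum_filter]
  refine Finset.sum_congr rfl fun τ _ => ?_
  rw [Polynomial.coeff_C_mul_X_pow]
  by_cases h : rawSlope d τ = e
  · simp [h]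
  · simp [h, Ne.symm h]


/-- Absolute value of a raw term = product of the absolute entries. [folklore] -/
theorem abs_rawCoef (S : Fin K → Matrix (Fin m) (Fin m) ℝ) (τ : RawTerm m K) : |rawCoef S τ| = ∏ i, |S (τ.2 i) (τ.1 i) i| := by
  rw [rawCoef, abs_mul, ← Finset.abs_prod]
  have : |((Equiv.Perm.sign τ.1 : ℤ) : ℝ)| = 1 := by
    rcases Int.units_eq_one_or (Equiv.Perm.sign τ.1) with h | h <;> simp [h]
  rw [this, one_mul]

/-- There are at most `2^{m(⌊log₂(mK)⌋+1)}` raw Leibniz terms (`m!·K^m ≤ (mK)^m`). [folklore] -/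
theorem card_rawTerm_le (m K : ℕ) : Fintype.card (RawTerm m K) ≤ 2 ^ (m * (Nat.log 2 (m * K) + 1)) := by
  classical
  have h1 : Fintype.card (Equiv.Perm (Fin m)) ≤ Fintype.card (Fin m → Fin m) :=
    Fintype.card_le_of_injective (fun σ : Equiv.Perm (Fin m) => (σ : Fin m → Fin m)) (fun a b h => Equiv.ext (congrFun h))
  rw [Fintype.card_prod]
  calc Fintype.card (Equiv.Perm (Fin m)) * Fintype.card (Fin m → Fin K)
      ≤ Fintype.card (Fin m → Fin m) * Fintype.card (Fin m → Fin K) := Nat.mul_le_mul_right _ h1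
    _ = (m * K) ^ m := by simp [mul_pow]
    _ ≤ (2 ^ (Nat.log 2 (m * K) + 1)) ^ m := Nat.pow_le_pow_left (Nat.lt_pow_succ_log_self (by norm_num) _).le _
    _ = 2 ^ (m * (Nat.log 2 (m * K) + 1)) := by rw [← pow_mul, mul_comm]

/-- `r/|r| = ±1` for `r ≠ 0`. [folklore] -/
theorem sign_div_abs (r : ℝ) (hr : r ≠ 0) : r / |r| = 1 ∨ r / |r| = -1 := by
  rcases lt_or_gt_of_ne hr with h | h
  · right; rw [abs_of_neg h, div_neg, div_self hr]
  · left; rw [abs_of_pos h, div_self hr]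

/-- **piece 2, PROVED** (depth confinement). [folklore] -/
theorem rootNearBreakpoint_proof : RootNearBreakpoint := by
  intro m K Δ d S hΔ x hx0 hf0 hroot
  classical
  set y := |x| with hy_def
  have hy : 0 < y := abs_pos.2 hx0
  have hyne : y ≠ 0 := hy.ne'
  set u := x / |x| with hu_def
  have hu : u = 1 ∨ u = -1 := sign_div_abs x hx0
  have huy : u * y = x := by rw [hu_def, hy_def]; exact div_mul_cancel₀ x (abs_ne_zero.2 hx0)
  have hupow : ∀ n : ℕ, u ^ n = 1 ∨ u ^ n = -1 := fun n => by
    rcases hu with h | h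
    · left; simp [h]
    · rw [h]; exact neg_one_pow_eq_or ℝ n
  -- the data for `rawConfinement` over ALL raw terms
  let a : RawTerm m K → ℝ := fun τ => |rawCoef S τ|
  let sg : RawTerm m K → ℝ := fun τ => if rawCoef S τ = 0 then 1 else rawCoef S τ / |rawCoef S τ| * u ^ rawSlope d τ
  have ha : ∀ τ, 0 ≤ a τ := fun τ => abs_nonneg _
  have hsg : ∀ τ, sg τ = 1 ∨ sg τ = -1 := fun τ => by
    by_cases h : rawCoef S τ = 0
    · left; simp [sg, h]
    · simp only [sg, if_neg h]
      rcases sign_div_abs _ h with h1 | h1 <;> rcases hupow (rawSlope d τ) with h2 | h2 <;> simp [h1, h2]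
  have hF1 : ∀ τ, sg τ * a τ = rawCoef S τ * u ^ rawSlope d τ := fun τ => by
    by_cases h : rawCoef S τ = 0
    · simp [sg, a, h]
    · simp only [sg, a, if_neg h]
      field_simp
  have hF2 : ∀ τ, sg τ * a τ * y ^ rawSlope d τ = rawCoef S τ * x ^ rawSlope d τ := fun τ => by
    rw [hF1, mul_assoc, ← mul_pow, huy]
  -- root equation
  have hroot' : ∑ τ, sg τ * a τ * y ^ (rawSlope d τ) = 0 := by
    simp_rw [hF2]; rw [← eval_pencilDet_eq_sum]; exact hroot
  -- depth hypothesis in raw currency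
  have hdepth' : ∀ e : ℕ, (∑ τ ∈ univ.filter (fun τ => rawSlope d τ = e), a τ) ≤
      (2 : ℝ) ^ Δ * |∑ τ ∈ univ.filter (fun τ => rawSlope d τ = e), sg τ * a τ| := by
    intro e
    have hL : (∑ τ ∈ univ.filter (fun τ => rawSlope d τ = e), a τ) =
        ∑ σ : Equiv.Perm (Fin m), ∑ lam : Fin m → Fin K, (if (∑ i, d (lam i)) = e then ∏ i, |S (lam i) (σ i) i| else 0) := by
      rw [Finset.sum_filter, Fintype.sum_prod_type]
      refine Finset.sum_congr rfl fun σ _ => Finset.sum_congr rfl fun lam _ => ?_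
      simp only [a, rawSlope, abs_rawCoef]
    have hR : (∑ τ ∈ univ.filter (fun τ => rawSlope d τ = e), sg τ * a τ) = u ^ e * (pencilDet d S).coeff e := by
      rw [coeff_pencilDet_eq_sum, Finset.mul_sum]
      refine Finset.sum_congr rfl fun τ hτ => ?_
      rw [hF1, (Finset.mem_filter.1 hτ).2, mul_comm]
    rw [hL, hR, abs_mul]
    have : |u ^ e| = 1 := by rcases hupow e with h | h <;> simp [h]
    rw [this, one_mul]
    exact hΔ e
  -- a present term exists, pick the top raw term τ₀
  obtain ⟨e₀, he₀⟩ : ∃ e, (pencilDet d S).coeff e ≠ 0 := by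
    by_contra hall; push Not at hall
    exact hf0 (Polynomial.ext fun e => by simpa using hall e)
  obtain ⟨τp, -, hτp⟩ : ∃ τ ∈ univ.filter (fun τ : RawTerm m K => rawSlope d τ = e₀), rawCoef S τ ≠ 0 := by
    rw [coeff_pencilDet_eq_sum] at he₀
    exact Finset.exists_ne_zero_of_sum_ne_zero he₀
  obtain ⟨τ₀, -, hmax⟩ := Finset.exists_max_image (univ : Finset (RawTerm m K)) (fun τ => a τ * y ^ rawSlope d τ) ⟨τp, mem_univ _⟩
  have hpos_p : 0 < a τp * y ^ rawSlope d τp := mul_pos (abs_pos.2 hτp) (pow_pos hy _)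
  have hpos₀ : 0 < a τ₀ * y ^ rawSlope d τ₀ := hpos_p.trans_le (hmax τp (mem_univ _))
  have ha₀ : 0 < a τ₀ := by
    by_contra h; push Not at h
    have : a τ₀ * y ^ rawSlope d τ₀ ≤ 0 := mul_nonpos_of_nonpos_of_nonneg h (pow_pos hy _).le
    linarith
  obtain ⟨τ₁, hs₁, hconf⟩ := rawConfinement (rawSlope d) a ha sg hsg Δ hdepth' y hy hroot' τ₀ ha₀
  set N := Fintype.card (RawTerm m K) with hN
  have hNpos : 0 < (N : ℝ) := by
    have : 0 < N := Fintype.card_pos_iff.2 ⟨τ₀⟩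
    exact_mod_cast this
  have ha₁ : 0 < a τ₁ := by
    by_contra h; push Not at h
    have h0 : a τ₁ = 0 := le_antisymm h (ha τ₁)
    rw [h0, zero_mul, mul_zero] at hconf
    linarith
  -- pass to logs over PRESENT terms
  let ι := {τ : RawTerm m K // rawCoef S τ ≠ 0}
  have hτ₀p : rawCoef S τ₀ ≠ 0 := abs_pos.1 ha₀
  have hτ₁p : rawCoef S τ₁ ≠ 0 := abs_pos.1 ha₁
  set θ := Real.logb 2 y with hθ
  have hlog_line : ∀ τ : RawTerm m K, rawCoef S τ ≠ 0 →
      Real.logb 2 (a τ * y ^ rawSlope d τ) = rawLog S τ + (rawSlope d τ : ℤ) * θ := by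
    intro τ hτ
    rw [Real.logb_mul (abs_pos.2 hτ).ne' (pow_ne_zero _ hyne), Real.logb_pow, rawLog]
    push_cast; ring
  have htop : ∀ k : ι, rawLog S k.1 + (rawSlope d k.1 : ℤ) * θ ≤ rawLog S τ₀ + (rawSlope d τ₀ : ℤ) * θ := by
    intro k
    rw [← hlog_line k.1 k.2, ← hlog_line τ₀ hτ₀p]
    exact Real.logb_le_logb_of_le (by norm_num) (mul_pos (abs_pos.2 k.2) (pow_pos hy _)) (hmax k.1 (mem_univ _))
  have hnear : rawLog S τ₀ + (rawSlope d τ₀ : ℤ) * θ ≤ rawLog S τ₁ + (rawSlope d τ₁ : ℤ) * θ + (Real.logb 2 N + Δ) := by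
    rw [← hlog_line τ₀ hτ₀p, ← hlog_line τ₁ hτ₁p]
    have h1 := Real.logb_le_logb_of_le (b := 2) (by norm_num) hpos₀ hconf
    have h2 : Real.logb 2 (N * (2 : ℝ) ^ Δ * (a τ₁ * y ^ rawSlope d τ₁)) =
        Real.logb 2 N + Δ + Real.logb 2 (a τ₁ * y ^ rawSlope d τ₁) := by
      rw [Real.logb_mul (by positivity) (mul_pos ha₁ (pow_pos hy _)).ne', Real.logb_mul hNpos.ne' (by positivity),
        Real.logb_pow, Real.logb_self_eq_one (by norm_num)]
      ring
    linarith
  have hs₁' : ((rawSlope d τ₀ : ℕ) : ℤ) ≠ ((rawSlope d τ₁ : ℕ) : ℤ) := by exact_mod_cast (Ne.symm hs₁)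
  obtain ⟨b, hb, k, l, hkl, htie, hall⟩ := envelopeGap (ι := ι) (fun t => (rawSlope d t.1 : ℤ)) (fun t => rawLog S t.1)
    (Real.logb 2 N + Δ) θ ⟨τ₀, hτ₀p⟩ ⟨τ₁, hτ₁p⟩ hs₁' htop hnear
  -- identify b as the design breakpoint of (k, l)
  have hkl' : (rawSlope d k.1 : ℝ) ≠ rawSlope d l.1 := by
    intro h; apply hkl; exact_mod_cast (show rawSlope d k.1 = rawSlope d l.1 by exact_mod_cast h)
  have hbcross : rawCross d S (k.1, l.1) = b := by
    rw [rawCross]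
    have htie' : rawLog S k.1 + (rawSlope d k.1 : ℝ) * b = rawLog S l.1 + (rawSlope d l.1 : ℝ) * b := by
      simpa [Int.cast_natCast] using htie
    rw [div_eq_iff (sub_ne_zero.2 (Ne.symm hkl'))]
    linarith
  refine ⟨b, ?_, ?_⟩
  · rw [designBreaks, Finset.mem_image]
    refine ⟨(k.1, l.1), ?_, hbcross⟩
    rw [Finset.mem_filter]
    refine ⟨mem_univ _, k.2, l.2, fun h => hkl (by exact_mod_cast h), fun t ht => ?_⟩
    rw [hbcross]
    have := hall ⟨t, ht⟩
    simpa [Int.cast_natCast] using this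
  · calc |θ - b| ≤ Real.logb 2 N + Δ := hb
      _ ≤ (m * (Nat.log 2 (m * K) + 1) : ℕ) + Δ := by
          have hc := card_rawTerm_le m K
          have h1 : (N : ℝ) ≤ (2 : ℝ) ^ (m * (Nat.log 2 (m * K) + 1)) := by rw [hN]; exact_mod_cast hc
          have h2 := Real.logb_le_logb_of_le (b := 2) (by norm_num) hNpos h1
          rw [Real.logb_pow, Real.logb_self_eq_one (by norm_num), mul_one] at h2
          push_cast at h2 ⊢
          linarith
      _ = ((m * (Nat.log 2 (m * K) + 1) + Δ : ℕ) : ℝ) := by push_cast; ring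


/-- The dyadic octave is the floor of `log₂|x|`. [folklore] -/
theorem octave_eq_floor (x : ℝ) : octave x = ⌊Real.logb 2 |x|⌋ := by
  have := Real.floor_logb_natCast (b := 2) (r := |x|) (abs_nonneg x)
  simp only [Nat.cast_ofNat] at this
  rw [octave, this]

open scoped Classical in
/-- **piece 3, PROVED** (unit-cell counting). [folklore] -/
theorem cellCount_proof : CellCount := by
  intro p B W h
  unfold octaveCount
  set R := p.roots.toFinset.filter (fun x => x ≠ 0) with hR
  have hsub : R.image octave ⊆ B.biUnion (fun b => Finset.Icc (⌊b⌋ - W) (⌊b⌋ + W)) := by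
    intro j hj
    obtain ⟨x, hx, rfl⟩ := Finset.mem_image.1 hj
    rw [hR, Finset.mem_filter, Multiset.mem_toFinset] at hx
    obtain ⟨hxr, hx0⟩ := hx
    have hroot : p.IsRoot x := (Polynomial.mem_roots'.1 hxr).2
    obtain ⟨b, hbB, hb⟩ := h x hx0 (Polynomial.mem_roots'.1 hxr).1 hroot
    rw [Finset.mem_biUnion]
    refine ⟨b, hbB, ?_⟩
    rw [Finset.mem_Icc, octave_eq_floor]
    rw [abs_le] at hb
    constructor
    · have h1 : (⌊b⌋ : ℝ) - W ≤ Real.logb 2 |x| := by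
        have := Int.floor_le b
        linarith
      have h2 : ((⌊b⌋ - (W : ℤ) : ℤ) : ℝ) ≤ Real.logb 2 |x| := by push_cast; exact h1
      exact Int.le_floor.2 h2
    · have h1 : Real.logb 2 |x| < (⌊b⌋ : ℝ) + 1 + W := by
        have := Int.lt_floor_add_one b
        linarith
      have h2 : Real.logb 2 |x| < (((⌊b⌋ + (W : ℤ) + 1 : ℤ)) : ℝ) := by push_cast; linarith
      have := Int.floor_lt.2 h2
      omega
  calc (R.image octave).card ≤ (B.biUnion (fun b => Finset.Icc (⌊b⌋ - W) (⌊b⌋ + W))).card := Finset.card_le_card hsub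
    _ ≤ ∑ b ∈ B, (Finset.Icc (⌊b⌋ - (W : ℤ)) (⌊b⌋ + W)).card := Finset.card_biUnion_le
    _ = ∑ _b ∈ B, (2 * W + 1) := Finset.sum_congr rfl fun b _ => by
        rw [Int.card_Icc]; omega
    _ = (2 * W + 1) * B.card := by rw [Finset.sum_const, smul_eq_mul, mul_comm]
    _ ≤ (2 * W + 2) * B.card := Nat.mul_le_mul_right _ (by omega)

end Depth

end Summit.ValiantsHypothesis.ValiantsHypothesis.Theorems.KPlusLogSqLaw.Octave
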